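import Mathlib
import HarnessLib

/-!
# `WakeRatchet.TailRatchet` (stmt-NavierStokesRegularity-21808), door D4′ — the LOWER blow-up rate of
# the dyadic chain: `sup_n Λⁿ|Xₙ(t)| ≥ 1/((Λ+Λ⁻¹)(T* − t))` («some shell is active at every instant»)

Def-free support lemmas for the aside crux `TailRatchet` (route `WakeRatchet`).  MODEL lattice ODEs only
(the scalar dyadic chain `Ẋₙ = Λⁿ⁻¹Xₙ₋₁² − ΛⁿXₙXₙ₊₁` of Tao 2016 §1.2 / §4 with `m = 1`, any `Λ > 0`);
nothing in this file is a statement about the Navier–Stokes equations; stmt-21808 is neither proved nor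
refuted here; no stub of skeleton d00b85951d7c is closed.

WHY.  Door D4′ of the item's census (`WakeRatchetTailRatchetStall`, `…StallLimit`, `…FiringClock`)
extracts a persistently firing eternal solution from the non-negative dyadic Cauchy blow-up; the
firing-window bookkeeping of `…FiringClock` takes as input «the lower blow-up rate (some shell is active
at every log-time)».  In the weighted amplitudes `bₙ = ΛⁿXₙ` the law reads
`ḃₙ = Λ bₙ₋₁² − Λ⁻¹ bₙ bₙ₊₁`, so `|ḃₙ| ≤ (Λ + Λ⁻¹)·(sup_m |b_m|)²`, and a sup bound `β` at time `t₀`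
propagates as `|bₙ(t)| ≤ 1/(β⁻¹ − (Λ+Λ⁻¹)(t − t₀))` (`sup_barrier`: real induction over ALL shells at
once against the strict super-solution `1/((β+δ)⁻¹ − K(1+δ)(t−t₀))`, using only an equi-Lipschitz bound
on the compact interval — the regularity of the trajectory — to open the induction to the right; then
`δ → 0`).  Read at the maximal time of regularity `T*` this is the lower rate
`sup_n |bₙ(t)| ≥ 1/((Λ+Λ⁻¹)(T* − t))` (`lower_rate_dyadic`; no sign condition, any `Λ > 0`).
Together with the companion upper (type-I) rate `bₙ(t) ≤ 2Λ²/((Λ−1)²(T* − t))`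
(`WakeRatchetDyadicTypeI.typeI_dyadic`) the renormalised frames `Wₙ(σ) = (T* − t) bₙ(t)` of a
non-negative dyadic blow-up are uniformly bounded AND uniformly active, with constants depending on
`Λ` only.

CONTENTS (def-free): `barrier_gap`, `den_pos` (the algebra of the explicit barrier), `sup_barrier_margin`
and `sup_barrier` (abstract: any index type, derivative controlled by the square of the sup),
`lower_rate_dyadic` (the ℤ-indexed dyadic chain).

HONEST FRAMING: elementary real analysis (a real-induction barrier argument); the wake-control inputs
of door D4′ (per-shell action, post-firing decay) and the extraction are NOT addressed; rung 0.
-/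

noncomputable section

set_option linter.dupNamespace false

namespace Summit.NavierStokesRegularity.NavierStokesRegularity.Theorems

namespace WakeRatchetDyadicLowerRate

open Set Filter Topology

/-! ## The explicit barrier `γ(t) = 1/(c − K′(t − t₀))` -/

/-- The barrier's increments: for `γ(r) = (c − K′(r − t₀))⁻¹` with positive denominators at `t ≤ s`,
`γ(s) − γ(t) ≥ K′(s−t)γ(t)²`. [folklore] -/
theorem barrier_gap {c K' t₀ t s : ℝ} (hK' : 0 ≤ K') (hts : t ≤ s)
    (hs : 0 < c - K' * (s - t₀)) :
    K' * (s - t) * ((c - K' * (t - t₀))⁻¹) ^ 2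
      ≤ (c - K' * (s - t₀))⁻¹ - (c - K' * (t - t₀))⁻¹ := by
  have ht : 0 < c - K' * (t - t₀) := by nlinarith
  have hmono : (c - K' * (t - t₀))⁻¹ ≤ (c - K' * (s - t₀))⁻¹ :=
    inv_anti₀ hs (by nlinarith)
  have hid : (c - K' * (s - t₀))⁻¹ - (c - K' * (t - t₀))⁻¹
      = K' * (s - t) * ((c - K' * (t - t₀))⁻¹ * (c - K' * (s - t₀))⁻¹) := by
    field_simp
    ring
  rw [hid, sq]
  have h1 : 0 ≤ K' * (s - t) := mul_nonneg hK' (by linarith)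
  have h2 : 0 < (c - K' * (t - t₀))⁻¹ := inv_pos.2 ht
  exact mul_le_mul_of_nonneg_left (mul_le_mul_of_nonneg_left hmono h2.le) h1

/-- Positivity of the barrier's denominator on `[t₀, t₁]` when `Kβ(t₁ − t₀) < 1`. [folklore] -/
theorem den_pos {K β t₀ t₁ t : ℝ} (hK : 0 ≤ K) (hβ : 0 < β) (h : K * β * (t₁ - t₀) < 1)
    (ht : t ≤ t₁) : 0 < β⁻¹ - K * (t - t₀) := by
  have h1 : β⁻¹ - K * (t₁ - t₀) = (1 - K * β * (t₁ - t₀)) / β := by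
    field_simp
  have h2 : 0 < β⁻¹ - K * (t₁ - t₀) := by
    rw [h1]; exact div_pos (by linarith) hβ
  nlinarith

/-! ## The sup barrier (real induction over all shells at once) -/

/-- **Sup barrier with margin.**  Let `b i` (`i` in any index type) be differentiable on `[t₀, t₁]` with
derivatives `db i` such that (i) at every instant the derivatives are controlled by the square of the
sup, `(∀ i', |b i' t| ≤ M) → |db i t| ≤ K M²`, (ii) the family is equi-Lipschitz on `[t₀, t₁]`
(`|db i t| ≤ L`), and (iii) `|b i t₀| ≤ β` for all `i` (`β > 0`).  Then for every margin `δ ∈ (0,1]`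
with `K(1+δ)(β+δ)(t₁ − t₀) < 1`:  `|b i t|·((β+δ)⁻¹ − K(1+δ)(t−t₀)) ≤ 1` on `[t₀, t₁]`.
[folklore (comparison with the Riccati majorant `ẏ = K y²` by real induction)] -/
theorem sup_barrier_margin {ι : Type*} {b db : ι → ℝ → ℝ} {K L β t₀ t₁ : ℝ} (hK : 0 < K)
    (hβ : 0 < β) (hL : 0 ≤ L)
    (hder : ∀ i, ∀ t ∈ Icc t₀ t₁, HasDerivAt (b i) (db i t) t)
    (hdb : ∀ i, ∀ t ∈ Icc t₀ t₁, ∀ M : ℝ, (∀ i', |b i' t| ≤ M) → |db i t| ≤ K * M ^ 2)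
    (hLip : ∀ i, ∀ t ∈ Icc t₀ t₁, |db i t| ≤ L)
    (h0 : ∀ i, |b i t₀| ≤ β) {δ : ℝ} (hδ : 0 < δ) (hδ1 : δ ≤ 1)
    (hδt : K * (1 + δ) * (β + δ) * (t₁ - t₀) < 1) :
    ∀ t ∈ Icc t₀ t₁, ∀ i, |b i t| * ((β + δ)⁻¹ - K * (1 + δ) * (t - t₀)) ≤ 1 := by
  set K' : ℝ := K * (1 + δ) with hK'def
  set β' : ℝ := β + δ with hβ'def
  have hK' : 0 < K' := by positivity
  have hβ' : 0 < β' := by positivity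
  have hδt' : K' * β' * (t₁ - t₀) < 1 := by rw [hK'def, hβ'def]; linarith
  -- positive denominators on `[t₀, t₁]`
  have hden : ∀ t ∈ Icc t₀ t₁, 0 < β'⁻¹ - K' * (t - t₀) := fun t ht =>
    den_pos hK'.le hβ' hδt' ht.2
  -- the barrier dominates `β'`
  have hγβ : ∀ t ∈ Icc t₀ t₁, β' ≤ (β'⁻¹ - K' * (t - t₀))⁻¹ := by
    intro t ht
    have h1 : β'⁻¹ - K' * (t - t₀) ≤ β'⁻¹ := by nlinarith [ht.1, hK']
    have h2 := inv_anti₀ (hden t ht) h1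
    rwa [inv_inv] at h2
  -- translation between the product form and the barrier inequality
  have hiff : ∀ t ∈ Icc t₀ t₁, ∀ i, (|b i t| * (β'⁻¹ - K' * (t - t₀)) ≤ 1 ↔
      |b i t| ≤ (β'⁻¹ - K' * (t - t₀))⁻¹) := by
    intro t ht i
    rw [show (β'⁻¹ - K' * (t - t₀))⁻¹ = 1 / (β'⁻¹ - K' * (t - t₀)) from inv_eq_one_div _,
      le_div_iff₀ (hden t ht)]
  -- the induction set
  set s : Set ℝ := {t | ∀ i, |b i t| * (β'⁻¹ - K' * (t - t₀)) ≤ 1} with hsdef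
  -- closedness of `s ∩ [t₀, t₁]`
  have hcont : ∀ i, ContinuousOn (fun t => |b i t| * (β'⁻¹ - K' * (t - t₀))) (Icc t₀ t₁) := by
    intro i
    have hb : ContinuousOn (b i) (Icc t₀ t₁) := fun t ht =>
      (hder i t ht).continuousAt.continuousWithinAt
    exact (continuous_abs.comp_continuousOn hb).mul (by fun_prop)
  have hclosed : IsClosed (s ∩ Icc t₀ t₁) := by
    have hEq : s ∩ Icc t₀ t₁ = Icc t₀ t₁ ∩ ⋂ i, (Icc t₀ t₁ ∩
        (fun t => |b i t| * (β'⁻¹ - K' * (t - t₀))) ⁻¹' Iic 1) := by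
      ext t
      simp only [hsdef, mem_inter_iff, mem_setOf_eq, mem_iInter, mem_preimage, mem_Iic]
      constructor
      · rintro ⟨h1, h2⟩; exact ⟨h2, fun i => ⟨h2, h1 i⟩⟩
      · rintro ⟨h2, h1⟩; exact ⟨fun i => (h1 i).2, h2⟩
    rw [hEq]
    exact isClosed_Icc.inter (isClosed_iInter fun i =>
      (hcont i).preimage_isClosed_of_isClosed isClosed_Icc isClosed_Iic)
  -- `t₀ ∈ s`
  have h0s : t₀ ∈ s := by
    simp only [hsdef, mem_setOf_eq]
    intro i
    rw [sub_self, mul_zero, sub_zero]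
    have : |b i t₀| ≤ β' := (h0 i).trans (by rw [hβ'def]; linarith)
    calc |b i t₀| * β'⁻¹ ≤ β' * β'⁻¹ := mul_le_mul_of_nonneg_right this (inv_nonneg.2 hβ'.le)
      _ = 1 := mul_inv_cancel₀ hβ'.ne'
  -- openness to the right
  have hstep : ∀ x ∈ s ∩ Ico t₀ t₁, s ∈ 𝓝[>] x := by
    rintro x ⟨hxs, hx⟩
    simp only [hsdef, mem_setOf_eq] at hxs
    have hxI : x ∈ Icc t₀ t₁ := Ico_subset_Icc_self hx
    -- the barrier value at `x`
    set gx : ℝ := (β'⁻¹ - K' * (x - t₀))⁻¹ with hgxdef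
    have hgxβ : β' ≤ gx := hγβ x hxI
    have hgx0 : 0 < gx := hβ'.trans_le hgxβ
    have hbx : ∀ i, |b i x| ≤ gx := fun i => (hiff x hxI i).1 (hxs i)
    -- the step size
    set η : ℝ := min (t₁ - x) (δ * β' / (3 * (L + 1))) with hηdef
    have hη0 : 0 < η := lt_min (by linarith [hx.2]) (by positivity)
    have hηt : η ≤ t₁ - x := min_le_left _ _
    have hηL : L * η ≤ δ * gx / 3 := by
      have h1 : η ≤ δ * β' / (3 * (L + 1)) := min_le_right _ _
      have h2 : L * η ≤ L * (δ * β' / (3 * (L + 1))) := mul_le_mul_of_nonneg_left h1 hL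
      have h3 : L * (δ * β' / (3 * (L + 1))) ≤ δ * β' / 3 := by
        rw [mul_div_assoc', div_le_div_iff₀ (by positivity) (by positivity)]
        nlinarith [hδ, hβ', hL]
      have h4 : δ * β' ≤ δ * gx := mul_le_mul_of_nonneg_left hgxβ hδ.le
      linarith
    -- claim: `(x, x + η) ⊆ s`
    have hsub : Ioo x (x + η) ⊆ s := by
      intro y hy
      simp only [hsdef, mem_setOf_eq]
      have hyI : y ∈ Icc t₀ t₁ := ⟨by linarith [hx.1, hy.1], by linarith [hy.2, hηt]⟩
      have hxy : x ≤ y := hy.1.le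
      have hrI : ∀ r ∈ Icc x y, r ∈ Icc t₀ t₁ := fun r hr =>
        ⟨hxI.1.trans hr.1, hr.2.trans hyI.2⟩
      -- Lipschitz from `x`: every shell stays within `L (r − x)` of its value at `x` on `[x, y]`
      have hLipx : ∀ i', ∀ r ∈ Icc x y, |b i' r| ≤ gx + L * (r - x) := by
        intro i' r hr
        have hmv := norm_image_sub_le_of_norm_deriv_le_segment' (f := b i') (f' := db i')
          (fun r' hr' => (hder i' r' (hrI r' hr')).hasDerivWithinAt)
          (fun r' hr' => by
            rw [Real.norm_eq_abs]; exact hLip i' r' (hrI r' (Ico_subset_Icc_self hr'))) r hr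
        rw [Real.norm_eq_abs] at hmv
        have := abs_sub_abs_le_abs_sub (b i' r) (b i' x)
        linarith [hbx i']
      intro i
      -- derivative bound `C = K (gx + Lη)²` on `[x, y)`, hence `|b i y| ≤ gx + C (y − x)`
      set C : ℝ := K * (gx + L * η) ^ 2 with hCdef
      have hmv2 := norm_image_sub_le_of_norm_deriv_le_segment' (f := b i) (f' := db i)
        (fun r hr => (hder i r (hrI r hr)).hasDerivWithinAt)
        (fun r hr => by
          rw [Real.norm_eq_abs]
          have hM : ∀ i', |b i' r| ≤ gx + L * η := fun i' =>
            (hLipx i' r (Ico_subset_Icc_self hr)).trans (by nlinarith [hr.2, hy.2, hL])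
          exact hdb i r (hrI r (Ico_subset_Icc_self hr)) (gx + L * η) hM) y (right_mem_Icc.2 hxy)
      rw [Real.norm_eq_abs] at hmv2
      have hby : |b i y| ≤ gx + C * (y - x) := by
        have := abs_sub_abs_le_abs_sub (b i y) (b i x)
        linarith [hbx i]
      -- barrier gain `γ(y) − γ(x) ≥ K′(y−x) γ(x)²`
      have hgap := barrier_gap (c := β'⁻¹) (t₀ := t₀) hK'.le hxy (hden y hyI)
      -- `C ≤ K′ γ(x)²`
      have hCK : C ≤ K' * gx ^ 2 := by
        rw [hCdef, hK'def]
        have h1 : gx + L * η ≤ (1 + δ / 3) * gx := by nlinarith [hηL]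
        have h2 : (gx + L * η) ^ 2 ≤ ((1 + δ / 3) * gx) ^ 2 :=
          pow_le_pow_left₀ (by positivity) h1 2
        have h3 : (1 + δ / 3) ^ 2 ≤ 1 + δ := by nlinarith [hδ, hδ1]
        calc K * (gx + L * η) ^ 2 ≤ K * ((1 + δ / 3) * gx) ^ 2 := mul_le_mul_of_nonneg_left h2 hK.le
          _ = K * (1 + δ / 3) ^ 2 * gx ^ 2 := by ring
          _ ≤ K * (1 + δ) * gx ^ 2 := by
              apply mul_le_mul_of_nonneg_right _ (sq_nonneg _)
              exact mul_le_mul_of_nonneg_left h3 hK.le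
      -- conclude `|b i y| ≤ γ(y)`
      have hγy : |b i y| ≤ (β'⁻¹ - K' * (y - t₀))⁻¹ := by
        have h1 : C * (y - x) ≤ K' * (y - x) * gx ^ 2 := by nlinarith [hCK, hxy]
        linarith [hby, hgap, h1]
      exact (hiff y hyI i).2 hγy
    exact mem_of_superset (Ioo_mem_nhdsGT (by linarith)) hsub
  -- real induction
  have hI := hclosed.Icc_subset_of_forall_mem_nhdsWithin h0s hstep
  intro t ht i
  have := hI ht
  simp only [hsdef, mem_setOf_eq] at this
  exact this i

/-- **Sup barrier.**  Under the hypotheses of `sup_barrier_margin` with `Kβ(t₁ − t₀) < 1`: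
`|b i t| ≤ 1/(β⁻¹ − K(t − t₀))` for all `i` and all `t ∈ [t₀, t₁]` — a sup bound propagates along the
Riccati majorant `ẏ = K y²`. [folklore] -/
theorem sup_barrier {ι : Type*} {b db : ι → ℝ → ℝ} {K L β t₀ t₁ : ℝ} (hK : 0 < K) (hβ : 0 < β)
    (hL : 0 ≤ L)
    (hder : ∀ i, ∀ t ∈ Icc t₀ t₁, HasDerivAt (b i) (db i t) t)
    (hdb : ∀ i, ∀ t ∈ Icc t₀ t₁, ∀ M : ℝ, (∀ i', |b i' t| ≤ M) → |db i t| ≤ K * M ^ 2)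
    (hLip : ∀ i, ∀ t ∈ Icc t₀ t₁, |db i t| ≤ L)
    (h0 : ∀ i, |b i t₀| ≤ β) (ht₁ : K * β * (t₁ - t₀) < 1) :
    ∀ i, ∀ t ∈ Icc t₀ t₁, |b i t| ≤ (β⁻¹ - K * (t - t₀))⁻¹ := by
  intro i t ht
  -- the bound with margin `δ`, for all small `δ > 0`
  have hev : ∀ᶠ δ in 𝓝[>] (0:ℝ), |b i t| ≤ ((β + δ)⁻¹ - K * (1 + δ) * (t - t₀))⁻¹ := by
    have hg : ContinuousAt (fun δ : ℝ => K * (1 + δ) * (β + δ) * (t₁ - t₀)) 0 := by fun_prop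
    have h1 : Iio (1:ℝ) ∈ 𝓝 ((fun δ : ℝ => K * (1 + δ) * (β + δ) * (t₁ - t₀)) 0) :=
      Iio_mem_nhds (by simp only [add_zero, mul_one]; exact ht₁)
    have hlt : ∀ᶠ δ in 𝓝[>] (0:ℝ), K * (1 + δ) * (β + δ) * (t₁ - t₀) < 1 :=
      mem_nhdsWithin_of_mem_nhds (hg.preimage_mem_nhds h1)
    have hle1 : ∀ᶠ δ in 𝓝[>] (0:ℝ), δ ∈ Ioc (0:ℝ) 1 := Ioc_mem_nhdsGT zero_lt_one
    filter_upwards [hlt, hle1] with δ hδt hδ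
    have hmain := sup_barrier_margin hK hβ hL hder hdb hLip h0 hδ.1 hδ.2 hδt t ht i
    have hd : 0 < (β + δ)⁻¹ - K * (1 + δ) * (t - t₀) := by
      have hδt' : K * (1 + δ) * (β + δ) * (t₁ - t₀) < 1 := hδt
      exact den_pos (K := K * (1 + δ)) (by have := hδ.1; positivity) (by linarith [hδ.1]) hδt' ht.2
    rw [show ((β + δ)⁻¹ - K * (1 + δ) * (t - t₀))⁻¹ = 1 / ((β + δ)⁻¹ - K * (1 + δ) * (t - t₀))
      from inv_eq_one_div _, le_div_iff₀ hd]
    exact hmain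
  -- the limit `δ → 0`
  have hden0 : 0 < β⁻¹ - K * (t - t₀) := den_pos hK.le hβ ht₁ ht.2
  have hc : ContinuousAt (fun δ : ℝ => ((β + δ)⁻¹ - K * (1 + δ) * (t - t₀))⁻¹) 0 := by
    refine ContinuousAt.inv₀ ?_ (by simpa using hden0.ne')
    exact (ContinuousAt.inv₀ (by fun_prop) (by simpa using hβ.ne')).sub (by fun_prop)
  have hlim : Tendsto (fun δ : ℝ => ((β + δ)⁻¹ - K * (1 + δ) * (t - t₀))⁻¹) (𝓝[>] 0)
      (𝓝 ((β⁻¹ - K * (t - t₀))⁻¹)) := by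
    have := hc.tendsto
    simp only [add_zero, mul_one] at this
    exact tendsto_nhdsWithin_of_tendsto_nhds this
  exact ge_of_tendsto hlim hev

/-! ## The ℤ-indexed dyadic chain: the lower blow-up rate -/

/-- **LOWER BLOW-UP RATE OF THE DYADIC CHAIN.**  Let `Λ > 0` and let `X : ℤ → ℝ → ℝ` solve
`Ẋₙ = Λⁿ⁻¹Xₙ₋₁² − ΛⁿXₙXₙ₊₁` at every shell on `(a, T)`, regular on every `(a, T′)`, `T′ < T`
(`Λⁿ|Xₙ| ≤ B` there) and NOT regular up to `T` (`Λⁿ|Xₙ|` unbounded on `(a,T)`: `T` is the blow-up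
time).  Then at every `t₀ ∈ (a, T)`, every bound `β` of `sup_n Λⁿ|Xₙ(t₀)|` obeys
`(Λ + Λ⁻¹)·β·(T − t₀) ≥ 1`: some shell is active at level `1/((Λ+Λ⁻¹)(T − t₀))` at every instant (no
sign condition).  With the type-I rate of `WakeRatchetDyadicTypeI.typeI_dyadic` the renormalised frames
of a non-negative blow-up are uniformly bounded and uniformly active — the two rate inputs of the
firing-window bookkeeping of door D4′ (`WakeRatchetFiringClock`).
[cite: Tao2016AveragedNS, §1.2 (the dyadic Katz–Pavlović model) and §4 Lemma 4.1 (4.8) with `m = 1`; elementary] -/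
theorem lower_rate_dyadic {Λ a T : ℝ} (hΛ : 0 < Λ) {X : ℤ → ℝ → ℝ}
    (hlaw : ∀ n : ℤ, ∀ t ∈ Ioo a T,
      HasDerivAt (X n) (Λ ^ (n - 1) * X (n - 1) t ^ 2 - Λ ^ n * X n t * X (n + 1) t) t)
    (hreg : ∀ T', T' < T → ∃ B : ℝ, ∀ n : ℤ, ∀ t ∈ Ioo a T', |Λ ^ n * X n t| ≤ B)
    (hblow : ∀ B : ℝ, ∃ n : ℤ, ∃ t ∈ Ioo a T, B < |Λ ^ n * X n t|)
    {t₀ : ℝ} (ht₀ : t₀ ∈ Ioo a T) {β : ℝ} (hβ : 0 < β) (hb : ∀ n : ℤ, |Λ ^ n * X n t₀| ≤ β) :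
    1 ≤ (Λ + Λ⁻¹) * β * (T - t₀) := by
  by_contra hcon
  push Not at hcon
  have hΛne : Λ ≠ 0 := hΛ.ne'
  set K : ℝ := Λ + Λ⁻¹ with hKdef
  have hK : 0 < K := by positivity
  -- weighted amplitudes and their law
  set b : ℤ → ℝ → ℝ := fun n t => Λ ^ n * X n t with hbdef
  set db : ℤ → ℝ → ℝ := fun n t =>
    Λ ^ n * (Λ ^ (n - 1) * X (n - 1) t ^ 2 - Λ ^ n * X n t * X (n + 1) t) with hdbdef
  have hder : ∀ n, ∀ t ∈ Ioo a T, HasDerivAt (b n) (db n t) t := by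
    intro n t ht
    have h := (hlaw n t ht).const_mul (Λ ^ n)
    simpa only [hbdef, hdbdef] using h
  have hdb_id : ∀ n t, db n t = Λ * b (n - 1) t ^ 2 - Λ⁻¹ * b n t * b (n + 1) t := by
    intro n t
    simp only [hbdef, hdbdef]
    have h1 : (Λ ^ n : ℝ) = Λ * Λ ^ (n - 1) := by
      rw [zpow_sub_one₀ hΛne]; field_simp
    have h2 : (Λ ^ (n + 1) : ℝ) = Λ ^ n * Λ := zpow_add_one₀ hΛne n
    rw [h2, h1]
    field_simp
  have hdb_bd : ∀ n t (M : ℝ), (∀ n', |b n' t| ≤ M) → |db n t| ≤ K * M ^ 2 := by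
    intro n t M hM
    have hM0 : 0 ≤ M := (abs_nonneg _).trans (hM n)
    rw [hdb_id n t]
    have h1 : |Λ * b (n - 1) t ^ 2 - Λ⁻¹ * b n t * b (n + 1) t|
        ≤ Λ * b (n - 1) t ^ 2 + Λ⁻¹ * (|b n t| * |b (n + 1) t|) := by
      have := abs_sub (Λ * b (n - 1) t ^ 2) (Λ⁻¹ * b n t * b (n + 1) t)
      have ha : |Λ * b (n - 1) t ^ 2| = Λ * b (n - 1) t ^ 2 := abs_of_nonneg (by positivity)
      have hb' : |Λ⁻¹ * b n t * b (n + 1) t| = Λ⁻¹ * (|b n t| * |b (n + 1) t|) := by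
        rw [abs_mul, abs_mul, abs_of_nonneg (inv_nonneg.2 hΛ.le)]; ring
      linarith [ha, hb']
    have h2 : b (n - 1) t ^ 2 ≤ M ^ 2 := by
      rw [← sq_abs]; exact pow_le_pow_left₀ (abs_nonneg _) (hM (n - 1)) 2
    have h3 : |b n t| * |b (n + 1) t| ≤ M * M :=
      mul_le_mul (hM n) (hM (n + 1)) (abs_nonneg _) hM0
    have h4 : Λ * b (n - 1) t ^ 2 ≤ Λ * M ^ 2 := mul_le_mul_of_nonneg_left h2 hΛ.le
    have h5 : Λ⁻¹ * (|b n t| * |b (n + 1) t|) ≤ Λ⁻¹ * (M * M) :=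
      mul_le_mul_of_nonneg_left h3 (inv_nonneg.2 hΛ.le)
    calc |Λ * b (n - 1) t ^ 2 - Λ⁻¹ * b n t * b (n + 1) t|
        ≤ Λ * M ^ 2 + Λ⁻¹ * (M * M) := by linarith
      _ = K * M ^ 2 := by rw [hKdef]; ring
  -- the forward bound on `[t₀, T)`
  have hBden : 0 < β⁻¹ - K * (T - t₀) := den_pos hK.le hβ hcon le_rfl
  have hfwd : ∀ t ∈ Ico t₀ T, ∀ n, |b n t| ≤ (β⁻¹ - K * (T - t₀))⁻¹ := by
    intro t ht n
    obtain ⟨B, hB⟩ := hreg ((t + T) / 2) (by linarith [ht.2])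
    have hsubI : ∀ r ∈ Icc t₀ t, r ∈ Ioo a ((t + T) / 2) := fun r hr =>
      ⟨ht₀.1.trans_le hr.1, by linarith [hr.2, ht.2]⟩
    have hsubT : ∀ r ∈ Icc t₀ t, r ∈ Ioo a T := fun r hr =>
      ⟨ht₀.1.trans_le hr.1, lt_of_le_of_lt hr.2 ht.2⟩
    have hB0 : 0 ≤ B := (abs_nonneg _).trans (hB 0 t₀ (hsubI t₀ (left_mem_Icc.2 ht.1)))
    have hKt : K * β * (t - t₀) < 1 := by
      have : K * β * (t - t₀) ≤ K * β * (T - t₀) :=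
        mul_le_mul_of_nonneg_left (by linarith [ht.2]) (by positivity)
      linarith
    have key := sup_barrier (ι := ℤ) (b := b) (db := db) (K := K) (L := K * B ^ 2) (β := β)
      (t₀ := t₀) (t₁ := t) hK hβ (by positivity)
      (fun n r hr => hder n r (hsubT r hr))
      (fun n r _ M hM => hdb_bd n r M hM)
      (fun n r hr => hdb_bd n r B (fun n' => hB n' r (hsubI r hr)))
      hb hKt n t (right_mem_Icc.2 ht.1)
    exact key.trans (inv_anti₀ hBden (by nlinarith [ht.2, hK]))
  -- the bound on `(a, t₀]` from regularity, and the contradiction with blow-up at `T`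
  obtain ⟨B₁, hB₁⟩ := hreg ((t₀ + T) / 2) (by linarith [ht₀.2])
  obtain ⟨n, t, ht, hbig⟩ := hblow (max B₁ ((β⁻¹ - K * (T - t₀))⁻¹))
  rcases lt_or_ge t t₀ with hlt | hge
  · have h := hB₁ n t ⟨ht.1, by linarith [ht₀.2]⟩
    exact absurd (lt_of_le_of_lt (le_max_left _ _) hbig) (not_lt.2 h)
  · have h := hfwd t ⟨hge, ht.2⟩ n
    exact absurd (lt_of_le_of_lt (le_max_right _ _) hbig) (not_lt.2 h)

end WakeRatchetDyadicLowerRate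

end Summit.NavierStokesRegularity.NavierStokesRegularity.Theorems

end
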